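import Summits.NavierStokesRegularity.NavierStokesRegularity.Theorems.HardyPointSinkHardyAncientLimitPressureA
import Literature.Analysis.FluidPDE.LocalTypeILscPressure
import Literature.Analysis.FluidPDE.LocalTypeIProofs
import Literature.Analysis.FluidPDE.PineauVicolOneSliceGradient
import Literature.Analysis.FluidPDE.PressureDeterminedUpToTime
import Literature.Analysis.FluidPDE.SereginSverakBlowupLimit
import Literature.Analysis.FluidPDE.SereginSverakBlowupRepresentative
import Literature.Analysis.FluidPDE.SereginSverakPressureDecayBalls
import Literature.Analysis.FluidPDE.ESSLocalHolderBlowupLimit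
import Literature.Analysis.FluidPDE.ClassicalSuitable
import Literature.Analysis.FluidPDE.CKN1982Setting
import Literature.Analysis.FunctionSpaces.WeakCompactnessLpFinite
import Literature.Analysis.FunctionSpaces.DiagonalSubsequence
import HarnessLib

/-!
# Route HardyPointSink — `HardyAncientLimit`, step 8c: the scaled pressure quantity `D` of the
# blow-up limit

Support file for item stmt-NavierStokesRegularity-9138 (`HardyAncientLimit`) of route
`HardyPointSink` (problem `NavierStokesRegularity`).

Let `(U_k, q_k)` be the rescaled classical solutions of the blow-up procedure, `U_{φ(j)} → w`
locally uniformly on `{s ≤ 0} × ℝ³`, `(w, P)` the classical (smooth, bounded, ancient) limit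
solution, and `D(Q(z,r); q_k) ≤ 𝐈₀` for large `k` on every parabolic ball below `s = 0`. Then
`D(Q(z,r); P) ≤ 𝐈₀` on every such ball (`HardyAncientLimit.cknDOsc_limit_le`): along a further
subsequence the gauged pressures converge weakly in `L^{3/2}_{loc}` to some `π`
(`HardyAncientLimit.exists_weakLimit_pressure`); passing to the limit in the distributional
momentum equations, `(w, π)` and `(w, P)` solve Navier–Stokes in `𝒟'` with the same velocity, so
`∇(P - π) = 0` in `𝒟'` and `P - π` is a function of time only (Rusin–Šverák 2011, §2;
`ae_exists_const_of_forall_integral_mul_divergence_eq_zero`); `D` does not see functions of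
time, and `D` of a weak limit is bounded by the `lim inf` (`cknDOsc_le_of_tendsto_weakly`).
This is the step "(3.6) follows from (3.3)" of Albritton–Barker 2019, §3, for the quantity `D`.

## References

* D. Albritton, T. Barker, arXiv:1811.00502, §3.
* W. Rusin, V. Šverák, J. Funct. Anal. 260 (2011), §2.
* G. Seregin, V. Šverák, Comm. PDE 34 (2009), §4.
-/

noncomputable section

open Literature.Analysis.FluidPDE Literature.Analysis.FluidPDE.SereginSverak2009
open Literature.Analysis.FunctionSpaces
open MeasureTheory Set Function Filter Topology Metric TopologicalSpace
open scoped ENNReal NNReal InnerProductSpace RealInnerProductSpace Laplacian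

namespace Summit.NavierStokesRegularity.NavierStokesRegularity.Theorems

namespace HardyAncientLimit

/-! ### Integrability on the cylinders `Q(R)` -/

/-- A field continuous on `{s ≤ 0} × ℝ³` is integrable on every `Q(R) = 𝒞(R) × (-R², 0)`
(continuous on the compact cylinder-with-top). [folklore] -/
theorem integrableOn_parCyl_of_continuousOn {F : Type*} [NormedAddCommGroup F]
    {f : ℝ × EuclideanSpace ℝ (Fin 3) → F} (hf : ContinuousOn f (Iic 0 ×ˢ univ)) (R : ℝ) :
    IntegrableOn f (parCyl 0 R) volume := by
  have hsub : Icc (-R ^ 2) 0 ×ˢ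
      {x : EuclideanSpace ℝ (Fin 3) | cylRadius x ≤ R ∧ |x 2| ≤ R} ⊆ Iic (0 : ℝ) ×ˢ univ :=
    fun z hz => ⟨hz.1.2, mem_univ _⟩
  exact ((hf.mono hsub).integrableOn_compact (isCompact_closedTop R)).mono_set
    (parCyl_subset_closedTop R)

/-- A field continuous on `𝒞(R+1) × ]-(R+1)², 0]` is integrable on `Q(R)`, `R ≥ 0` (continuous on
the compact cylinder-with-top `[-R², 0] × {|x'| ≤ R, |x₃| ≤ R}`). [folklore] -/
theorem integrableOn_parCyl_of_continuousOn_parCylTop {F : Type*} [NormedAddCommGroup F]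
    {f : ℝ × EuclideanSpace ℝ (Fin 3) → F} {R : ℝ} (hR : 0 ≤ R)
    (hf : ContinuousOn f (parCylTop (R + 1))) : IntegrableOn f (parCyl 0 R) volume :=
  ((hf.mono (closedTop_subset_parCylTop hR (lt_add_one R))).integrableOn_compact
    (isCompact_closedTop R)).mono_set (parCyl_subset_closedTop R)

/-- **Classical solutions on an open time set solve Navier–Stokes in `𝒟'(Q(R))`** whenever
`Q(R) ⊆ S × ℝ³` (`C²` classical solutions are distributional solutions, CKN 1982, §2 (2.2)).
[cite: CaffarelliKohnNirenberg1982, §2 (2.2)] -/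
theorem isDistributional_of_classical {S : Set ℝ} (hS : IsOpen S)
    {w : ℝ → EuclideanSpace ℝ (Fin 3) → EuclideanSpace ℝ (Fin 3)}
    {P : ℝ → EuclideanSpace ℝ (Fin 3) → ℝ} (hcl : IsClassicalNSSolutionOn S 1 0 w P) {R : ℝ}
    (hRS : parCyl 0 R ⊆ S ×ˢ univ) :
    IsDistributionalNSSolutionOn (parCylOpens 0 R) 1 0 w P := by
  have hQ : ((parCylOpens 0 R : Opens (ℝ × EuclideanSpace ℝ (Fin 3))) :
      Set (ℝ × EuclideanSpace ℝ (Fin 3))) ⊆ S ×ˢ univ := by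
    rw [coe_parCylOpens]
    exact hRS
  have htop : ((2 : ℕ∞) : WithTop ℕ∞) ≤ ((⊤ : ℕ∞) : WithTop ℕ∞) := by exact_mod_cast le_top
  have htop' : ((1 : ℕ∞) : WithTop ℕ∞) ≤ ((⊤ : ℕ∞) : WithTop ℕ∞) := by exact_mod_cast le_top
  have hu : ContDiffOn ℝ 2 (uncurry w) (S ×ˢ univ) := hcl.smooth_velocity.of_le htop
  have hp : ContDiffOn ℝ 1 (uncurry P) (S ×ˢ univ) := hcl.smooth_pressure.of_le htop'
  have hf : ContinuousOn (uncurry (0 : ℝ → EuclideanSpace ℝ (Fin 3) → EuclideanSpace ℝ (Fin 3)))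
      (S ×ˢ univ) := continuousOn_const
  have hmom : ∀ t ∈ S, ∀ x, timeDeriv w t x + convect (w t) (w t) x =
      (1 : ℝ) • (Δ (w t)) x - gradient (P t) x +
        (0 : ℝ → EuclideanSpace ℝ (Fin 3) → EuclideanSpace ℝ (Fin 3)) t x := by
    intro t ht x
    have hti : t ∈ interior S := by rwa [hS.interior_eq]
    rw [← timeDerivWithin_of_mem_interior hti x]
    exact hcl.momentum t ht x
  exact isDistributionalNSSolutionOn_of_contDiffOn hS hQ hu hp hf hmom hcl.divFree

/-- **The classical limit solves Navier–Stokes in `𝒟'(Q(R))`** (`C²` classical solutions are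
distributional solutions, CKN 1982, §2 (2.2)). [cite: CaffarelliKohnNirenberg1982, §2 (2.2)] -/
theorem isDistributional_of_classical_Iio
    {w : ℝ → EuclideanSpace ℝ (Fin 3) → EuclideanSpace ℝ (Fin 3)}
    {P : ℝ → EuclideanSpace ℝ (Fin 3) → ℝ} (hcl : IsClassicalNSSolutionOn (Iio 0) 1 0 w P) (R : ℝ) :
    IsDistributionalNSSolutionOn (parCylOpens 0 R) 1 0 w P :=
  isDistributional_of_classical isOpen_Iio hcl (parCyl_subset_Iio_prod R)

/-! ### The identity `∫∫ (P - π) div ψ = 0` -/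

/-- **Passing to the limit in the momentum equations.** With `U_{η(j)} → w` uniformly on each
`Q(N+1)` (the `U_k` continuous on `{s ≤ 0} × ℝ³` and bounded by `1` on `Q(N+1)` for large `k`),
`(U_k, q_k)` distributional solutions on each `Q(N+1)` for large `k`, the gauged pressures
`q̃_{η(j)} ⇀ π` weakly in `L^{3/2}(Q(0, m+2))` for every `m`, and `(w, P)` classical on `s < 0`:
for every vector test field `ψ` supported in `(T₁, 0) × ℝ³`, `∫∫ (P - π) div ψ = 0` (both
`∫∫ P div ψ` and `∫∫ π div ψ` equal `-lim ∫∫ (⟪U, ∂ₜψ⟫ + ⟪U, (U·∇)ψ⟫ + ⟪U, Δψ⟫)`).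
[cite: AlbrittonBarker2019, §3 (3.5)–(3.6)] -/
theorem setIntegral_sub_mul_divergence_eq_zero
    {U : ℕ → ℝ → EuclideanSpace ℝ (Fin 3) → EuclideanSpace ℝ (Fin 3)}
    {Pq : ℕ → ℝ → EuclideanSpace ℝ (Fin 3) → ℝ} {η : ℕ → ℕ}
    {w : ℝ → EuclideanSpace ℝ (Fin 3) → EuclideanSpace ℝ (Fin 3)}
    {P π : ℝ → EuclideanSpace ℝ (Fin 3) → ℝ} (hη : StrictMono η)
    (hUc : ∀ a : ℝ, 0 < a → ∀ᶠ k in atTop, ContinuousOn (uncurry (U k)) (parCylTop a))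
    (hUb : ∀ a : ℝ, 0 < a → ∀ᶠ k in atTop, ∀ z ∈ parCylTop a, ‖U k z.1 z.2‖ ≤ 1)
    (hunif : ∀ N : ℕ, TendstoUniformlyOn (fun j => uncurry (U (η j))) (uncurry w) atTop
      (parCyl 0 ((N : ℝ) + 1)))
    (hPc : ∀ᶠ k in atTop, ContinuousOn (uncurry (Pq k)) (Iic 0 ×ˢ univ))
    (hNS : ∀ N : ℕ, ∀ᶠ k in atTop,
      IsDistributionalNSSolutionOn (parCylOpens 0 ((N : ℝ) + 1)) 1 0 (U k) (Pq k))
    (hcl : IsClassicalNSSolutionOn (Iio 0) 1 0 w P)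
    (hπ : ∀ m : ℕ, MemLp (uncurry π) (3 / 2)
        (volume.restrict (parabolicCylinder ((m : ℝ) + 2) (0 : ℝ × EuclideanSpace ℝ (Fin 3)))) ∧
      ∀ g : ℝ × EuclideanSpace ℝ (Fin 3) → ℝ,
        MemLp g 3 (volume.restrict (parabolicCylinder ((m : ℝ) + 2)
          (0 : ℝ × EuclideanSpace ℝ (Fin 3)))) →
        Tendsto (fun j => ∫ z in parabolicCylinder ((m : ℝ) + 2) (0 : ℝ × EuclideanSpace ℝ (Fin 3)),
            (Pq (η j) z.1 z.2 - ⨍ y in closedBall (0 : EuclideanSpace ℝ (Fin 3)) 1,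
              Pq (η j) (min z.1 0) y) * g z) atTop
          (𝓝 (∫ z in parabolicCylinder ((m : ℝ) + 2) (0 : ℝ × EuclideanSpace ℝ (Fin 3)),
            π z.1 z.2 * g z)))
    {T₁ : ℝ} {ψ : ℝ → EuclideanSpace ℝ (Fin 3) → EuclideanSpace ℝ (Fin 3)}
    (hψ : IsSpaceTimeTestOn (slab (EuclideanSpace ℝ (Fin 3)) (Ioo T₁ 0) isOpen_Ioo) ψ) :
    ∫ z in Ioo T₁ 0 ×ˢ (univ : Set (EuclideanSpace ℝ (Fin 3))),
      (P z.1 z.2 - π z.1 z.2) * VectorCalculus.divergence (ψ z.1) z.2 = 0 := by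
  haveI : ENNReal.HolderTriple (3 / 2 : ℝ≥0∞) 3 1 := holderTriple_threeHalves_three_one'
  -- the support and the cylinders `C = Q(n+1) ⊆ Q(0, 2n+2)`
  set K : Set (ℝ × EuclideanSpace ℝ (Fin 3)) := tsupport (uncurry ψ) with hK
  have hKc : IsCompact K := hψ.hasCompactSupport
  have hKslab : K ⊆ Ioo T₁ 0 ×ˢ univ := by
    intro z hz
    have h := hψ.tsupport_subset hz
    rw [coe_slab] at h
    exact h
  have hK0 : K ⊆ Iio 0 ×ˢ univ := fun z hz => ⟨(hKslab hz).1.2, mem_univ _⟩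
  obtain ⟨n, hn⟩ := exists_nat_subset_parCyl hKc hK0
  set C : Set (ℝ × EuclideanSpace ℝ (Fin 3)) := parCyl 0 ((n : ℝ) + 1) with hC
  have hCm : MeasurableSet C := (isOpen_parCyl 0 _).measurableSet
  haveI hCfin : IsFiniteMeasure (volume.restrict C) :=
    ⟨by rw [Measure.restrict_apply_univ]; exact volume_parCyl_lt_top _⟩
  have hn0 : (0 : ℝ) ≤ (n : ℝ) + 1 := by positivity
  have hCQ : C ⊆ parabolicCylinder ((((2 * n : ℕ)) : ℝ) + 2) (0 : ℝ × EuclideanSpace ℝ (Fin 3)) := by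
    refine (parCyl_subset_parabolicCylinder 0 hn0).trans (parabolicCylinder_mono (by positivity) ?_ 0)
    have h2 : Real.sqrt 2 ≤ 2 := by
      rw [show (2 : ℝ) = Real.sqrt 4 by rw [show (4 : ℝ) = 2 ^ 2 by norm_num, Real.sqrt_sq (by norm_num)]]
      exact Real.sqrt_le_sqrt (by norm_num)
    push_cast
    nlinarith
  -- the divergence of the test field
  obtain ⟨hdc, hd0⟩ := hψ.continuous_divergence_field
  set d : ℝ × EuclideanSpace ℝ (Fin 3) → ℝ := fun z => VectorCalculus.divergence (ψ z.1) z.2 with hd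
  have hdK : ∀ z ∉ K, d z = 0 := hd0
  have hdsupp : HasCompactSupport d := HasCompactSupport.intro hKc hdK
  obtain ⟨Md, hMd⟩ := hdc.bounded_above_of_compact_support hdsupp
  have hd3 : ∀ S : Set (ℝ × EuclideanSpace ℝ (Fin 3)), IsFiniteMeasure (volume.restrict S) →
      MemLp d 3 (volume.restrict S) := fun S hS =>
    (memLp_top_of_bound hdc.aestronglyMeasurable Md (Eventually.of_forall hMd)).mono_exponent le_top
  -- (a) the weak limit tested against `div ψ` on `C`
  have ha : Tendsto (fun j => ∫ z in C, (Pq (η j) z.1 z.2 -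
      ⨍ y in closedBall (0 : EuclideanSpace ℝ (Fin 3)) 1, Pq (η j) (min z.1 0) y) * d z) atTop
      (𝓝 (∫ z in C, π z.1 z.2 * d z)) :=
    SuitableCompactness.tendsto_setIntegral_mul_of_subset hCm hCQ
      (f := fun j z => Pq (η j) z.1 z.2 -
        ⨍ y in closedBall (0 : EuclideanSpace ℝ (Fin 3)) 1, Pq (η j) (min z.1 0) y)
      (g := fun z => π z.1 z.2) (hπ (2 * n)).2 d (hd3 C hCfin)
  -- the test field on `Q(n+1)` and on `⊤`
  have hψC : IsSpaceTimeTestOn (parCylOpens 0 ((n : ℝ) + 1)) ψ :=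
    ⟨hψ.contDiff, hψ.hasCompactSupport, by simpa only [coe_parCylOpens] using hn⟩
  have hψtop : IsSpaceTimeTestOn (⊤ : Opens (ℝ × EuclideanSpace ℝ (Fin 3))) ψ := hψ.mono le_top
  -- the Navier–Stokes integrand
  set nsI : (ℝ × EuclideanSpace ℝ (Fin 3) → EuclideanSpace ℝ (Fin 3)) →
      ℝ × EuclideanSpace ℝ (Fin 3) → ℝ := fun V z =>
    ⟪V z, timeDeriv ψ z.1 z.2⟫ + ⟪V z, fderiv ℝ (ψ z.1) z.2 (V z)⟫ + ⟪V z, Δ (ψ z.1) z.2⟫ with hnsI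
  -- from a distributional identity on `Q(n+1)`: `∫_C q div ψ = -∫_C nsI(V)`
  have hident : ∀ (V : ℝ → EuclideanSpace ℝ (Fin 3) → EuclideanSpace ℝ (Fin 3))
      (q : ℝ → EuclideanSpace ℝ (Fin 3) → ℝ),
      IsDistributionalNSSolutionOn (parCylOpens 0 ((n : ℝ) + 1)) 1 0 V q →
      IntegrableOn (nsI (uncurry V)) C volume →
      IntegrableOn (fun z => q z.1 z.2 * d z) C volume →
      ∫ z in C, q z.1 z.2 * d z = -∫ z in C, nsI (uncurry V) z := by
    intro V q hVq hI1 hI2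
    have key := hVq.2.2.2.2 ψ hψC
    rw [coe_parCylOpens] at key
    have key' : ∫ z in C, (nsI (uncurry V) z + q z.1 z.2 * d z) = 0 := by
      refine (setIntegral_congr_fun hCm fun z _ => ?_).trans key
      simp only [hnsI, hd, convect_apply, one_mul, Pi.zero_apply, inner_zero_left, add_zero]
      rfl
    rw [integral_add hI1 hI2] at key'
    linarith
  -- (b) the terms of the sequence, for large `j`
  have hη' : Tendsto η atTop atTop := hη.tendsto_atTop
  have hb : ∀ᶠ j in atTop, ∫ z in C, (Pq (η j) z.1 z.2 -
      ⨍ y in closedBall (0 : EuclideanSpace ℝ (Fin 3)) 1, Pq (η j) (min z.1 0) y) * d z =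
      -∫ z in C, nsI (uncurry (U (η j))) z := by
    filter_upwards [hη'.eventually (hUc ((n : ℝ) + 1 + 1) (by positivity)), hη'.eventually hPc,
      hη'.eventually (hNS n)] with j hUj hPj hNSj
    refine hident (U (η j)) _ (isDistributional_gauged hPj hNSj) ?_ ?_
    · exact integrableOn_parCyl_of_continuousOn_parCylTop hn0 (continuousOn_nsIntegrand hψtop hUj)
    · exact integrableOn_parCyl_of_continuousOn ((continuousOn_gauged hPj).mul hdc.continuousOn) _
  -- (c) the limit of the Navier–Stokes integrals
  have hunifC : TendstoUniformlyOn (fun j => uncurry (U (η j))) (uncurry w) atTop C := hunif n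
  have hcontC : ∀ᶠ j in atTop, ContinuousOn (uncurry (U (η j))) C := by
    filter_upwards [hη'.eventually (hUc ((n : ℝ) + 1) (by positivity))] with j hj
    exact hj.mono (parCyl_zero_subset_parCylTop _)
  have hbC : ∀ᶠ j in atTop, ∀ z ∈ C, ‖uncurry (U (η j)) z‖ ≤ 1 := by
    filter_upwards [hη'.eventually (hUb ((n : ℝ) + 1) (by positivity))] with j hj
    exact fun z hz => hj z (parCyl_zero_subset_parCylTop _ hz)
  have hc : Tendsto (fun j => ∫ z in C, nsI (uncurry (U (η j))) z) atTop
      (𝓝 (∫ z in C, nsI (uncurry w) z)) :=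
    tendsto_setIntegral_nsIntegrand hunifC hcontC hbC hψtop
  -- (d) the limit solution
  have hwc : ContinuousOn (uncurry w) C :=
    hcl.smooth_velocity.continuousOn.mono ((parCyl_subset_Iio_prod _))
  have hPcont : ContinuousOn (uncurry P) (Iio 0 ×ˢ univ) := hcl.smooth_pressure.continuousOn
  have hIP : IntegrableOn (fun z => P z.1 z.2 * d z) C volume := by
    have h1 : IntegrableOn (fun z => P z.1 z.2 * d z) K volume :=
      ((hPcont.mono hK0).mul hdc.continuousOn).integrableOn_compact hKc
    exact h1.of_forall_sdiff_eq_zero hCm fun z hz => by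
      change P z.1 z.2 * d z = 0
      rw [hdK z hz.2, mul_zero]
  have hInsW : IntegrableOn (nsI (uncurry w)) C volume := by
    -- continuous on `C`, bounded (`|w| ≤ 1` on `C` as a uniform limit), finite measure
    obtain ⟨M₁, -, hM₁⟩ := hψtop.timeDeriv_top.exists_norm_le
    obtain ⟨M₂, hM₂0, hM₂⟩ := hψtop.fderiv_top.exists_norm_le
    obtain ⟨M₃, -, hM₃⟩ := hψtop.laplacian_top.exists_norm_le
    have hwb : ∀ z ∈ C, ‖uncurry w z‖ ≤ 1 := by
      intro z hz
      refine le_of_forall_pos_lt_add fun ε hε => ?_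
      have h1 := Metric.tendstoUniformlyOn_iff.1 hunifC ε hε
      obtain ⟨j, hj1, hj2⟩ := ((h1.and hbC).exists)
      calc ‖uncurry w z‖ ≤ ‖uncurry (U (η j)) z‖ + dist (uncurry w z) (uncurry (U (η j)) z) := by
            rw [dist_eq_norm]
            exact norm_le_insert' _ _
        _ < 1 + ε := by linarith [hj1 z hz, hj2 z hz]
    refine ⟨(continuousOn_nsIntegrand hψtop hwc).aestronglyMeasurable hCm,
      HasFiniteIntegral.restrict_of_bounded (C := M₁ + M₂ + M₃) (volume_parCyl_lt_top _) ?_⟩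
    filter_upwards [ae_restrict_mem hCm] with z hz
    have hv : ‖uncurry w z‖ ≤ 1 := hwb z hz
    have h1 : ‖⟪uncurry w z, timeDeriv ψ z.1 z.2⟫‖ ≤ M₁ :=
      (norm_inner_le_norm _ _).trans ((mul_le_mul hv (hM₁ z.1 z.2) (norm_nonneg _)
        zero_le_one).trans_eq (one_mul _))
    have h2 : ‖⟪uncurry w z, fderiv ℝ (ψ z.1) z.2 (uncurry w z)⟫‖ ≤ M₂ := by
      have hA : ‖fderiv ℝ (ψ z.1) z.2 (uncurry w z)‖ ≤ M₂ :=
        ((fderiv ℝ (ψ z.1) z.2).le_opNorm _).trans ((mul_le_mul (hM₂ z.1 z.2) hv (norm_nonneg _)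
          hM₂0).trans_eq (mul_one _))
      exact (norm_inner_le_norm _ _).trans ((mul_le_mul hv hA (norm_nonneg _)
        zero_le_one).trans_eq (one_mul _))
    have h3 : ‖⟪uncurry w z, Δ (ψ z.1) z.2⟫‖ ≤ M₃ :=
      (norm_inner_le_norm _ _).trans ((mul_le_mul hv (hM₃ z.1 z.2) (norm_nonneg _)
        zero_le_one).trans_eq (one_mul _))
    exact (norm_add₃_le.trans (add_le_add_three h1 h2 h3))
  have hdW : ∫ z in C, P z.1 z.2 * d z = -∫ z in C, nsI (uncurry w) z :=
    hident w P (isDistributional_of_classical_Iio hcl _) hInsW hIP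
  -- (e) uniqueness of limits: `∫_C π div ψ = ∫_C P div ψ`
  have hlim2 : Tendsto (fun j => ∫ z in C, (Pq (η j) z.1 z.2 -
      ⨍ y in closedBall (0 : EuclideanSpace ℝ (Fin 3)) 1, Pq (η j) (min z.1 0) y) * d z) atTop
      (𝓝 (∫ z in C, P z.1 z.2 * d z)) := by
    rw [hdW]
    exact (hc.neg).congr' (hb.mono fun j hj => hj.symm)
  have hπP : ∫ z in C, π z.1 z.2 * d z = ∫ z in C, P z.1 z.2 * d z := tendsto_nhds_unique ha hlim2
  -- (f) back to the slab
  have hIπ : IntegrableOn (fun z => π z.1 z.2 * d z) C volume :=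
    ((hπ (2 * n)).1.mono_measure (Measure.restrict_mono hCQ le_rfl)).integrable_mul (hd3 C hCfin)
  have hzero : ∀ z ∉ K, (P z.1 z.2 - π z.1 z.2) * d z = 0 := fun z hz => by rw [hdK z hz, mul_zero]
  calc ∫ z in Ioo T₁ 0 ×ˢ (univ : Set (EuclideanSpace ℝ (Fin 3))), (P z.1 z.2 - π z.1 z.2) * d z
      = ∫ z, (P z.1 z.2 - π z.1 z.2) * d z :=
        setIntegral_eq_integral_of_forall_compl_eq_zero fun z hz => hzero z fun h => hz (hKslab h)
    _ = ∫ z in C, (P z.1 z.2 - π z.1 z.2) * d z :=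
        (setIntegral_eq_integral_of_forall_compl_eq_zero fun z hz => hzero z fun h => hz (hn h)).symm
    _ = (∫ z in C, P z.1 z.2 * d z) - ∫ z in C, π z.1 z.2 * d z := by
        rw [← integral_sub hIP hIπ]
        refine setIntegral_congr_fun hCm fun z _ => ?_
        ring
    _ = 0 := by rw [hπP, sub_self]

end HardyAncientLimit

end Summit.NavierStokesRegularity.NavierStokesRegularity.Theorems

end
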